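import Mathlib
import Literature.Computability.AlgebraicComplexity.MatrixMultiplicationExponent
import Literature.RingTheory.MvPolynomial.MultigradedHilbertFunction

/-!
# `FidelityWitnesses.FidelityGapThreeSeventeen` (stmt-MatrixMultiplication-4958) — vocabulary of the line
# `punctual-saturation` (Borel-fixed border apolarity at `r = 17` + Jelisiejew–Mańdziuk sticky saturation)

Definitions only (plus two sanity lemmas and the landing hook `stub_punctualVocabulary`; no statement of the route is
asserted).  This is the shared vocabulary of the checked skeleton `Cruxes/FidelityGapThreeSeventeen/Lines/punctual-saturation.lean`
(crux-plan 2026-08-16; picked by the line lead after `symbolic-square-border-apolarity` died, `Cruxes/…/PICKED.md`), landed so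
that the five registered stubs (`stub_borelFixedApolarity`, `stub_punctual`, `stub_noSaturatedCandidate`, `stub_stickySaturation`,
`stub_sticky_not_slip`) can be proved in separate `Theorems/` files against ONE set of constants:

* the `ℕ³`-graded Cox ring `S = ℂ[C ⊕ A ⊕ B]` of `ℙ⁸ × ℙ⁸ × ℙ⁸` (27 variables `(s,i,j)`, slot `s = 0` the output `C`, `1` = `A`, `2` = `B`),
  its pieces `SD D`, the pieces `piece I D` / `hdim I D` of an ideal, trihomogeneity, the generic Hilbert function `HasGenericHF`
  of `17` points, the apolarity pairing `pairT` with `⟨3,3,3⟩` and `IsCandidate`;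
* the Borel action of `B₃ × B₃ × B₃ ⊂ GL₃³` by substitution (`borelVar`, `borelSubst`, `IsBorelStable`), the irrelevant ideal, the
  saturation `satur`, the flag point's corner variables and `IsPunctual`;
* configurations of `17` points, `InGeneralPosition`, degreewise convergence (`CoeffTendsto`, `PiecesTendsto`), Slip witnesses /
  limits (`IsSlipWitness`, `IsSlipLimit`) and sequential stickiness `Sticky I J` (Jelisiejew–Mańdziuk, arXiv:2210.13579, §1.2/Thm 3.4
  in sequential form).

Sources: W. Buczyńska, J. Buczyński, Duke Math. J. 170 (2021) Thm 1.2/4.3 (border apolarity, Borel-fixed form); A. Conner, A. Harper,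
J. M. Landsberg, Forum Math. Pi 11 (2023) e17, §2.3–2.4; J. Jelisiejew, T. Mańdziuk, *Limits of saturated ideals*, arXiv:2210.13579,
Def. 3.10, Thm 3.4–3.6.  What is NOT here: any theorem about the route.
-/

noncomputable section

namespace Summit.MatrixMultiplication.MatrixMultiplication.Theorems.PunctualSaturation

-- single-conjunct summit: the `Summit.<S>.<P>` prefix repeats `MatrixMultiplication` by design (D-0017)
set_option linter.dupNamespace false

open scoped BigOperators Topology
open Filter MvPolynomial
open Literature.Computability.AlgebraicComplexity

/-! ## Vocabulary: the trigraded Cox ring of `ℙC × ℙA × ℙB` -/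

/-- Variables of `S`: `(s, i, j)` is the coordinate `(i, j)` on slot `s` of `matMulTensor ℂ 3 3 3`
(`s = 0`: `c_{κν}` on the output slot `C`; `s = 1`: `a_{κμ}` on `A`; `s = 2`: `b_{μν}` on `B`). -/
abbrev Var : Type := Fin 3 × Fin 3 × Fin 3

/-- `S = ℂ[C ⊕ A ⊕ B]`, the Cox ring of `ℙ⁸ × ℙ⁸ × ℙ⁸` (`27` variables). -/
abbrev S : Type := MvPolynomial Var ℂ

/-- The `ℕ³`-grading: the variable `(s, i, j)` has multidegree `e_s` (the tree's block-grading
convention `fun i => Pi.single (blk i) 1` of `MultigradedHilbertFunction.lean`, `blk = Prod.fst`). -/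
def wt : Var → (Fin 3 → ℕ) := fun v => Pi.single v.1 1

/-- The piece `S_D` of multidegree `D ∈ ℕ³`. -/
abbrev SD (D : Fin 3 → ℕ) : Submodule ℂ S := weightedHomogeneousSubmodule ℂ wt D

/-- The piece `I_D = I ∩ S_D` of an ideal. -/
abbrev piece (I : Ideal S) (D : Fin 3 → ℕ) : Submodule ℂ S := Submodule.restrictScalars ℂ I ⊓ SD D

/-- `dim_ℂ I_D`. -/
abbrev hdim (I : Ideal S) (D : Fin 3 → ℕ) : ℕ := Module.finrank ℂ ↥(piece I D)

/-- `I` is trihomogeneous (closed under taking multihomogeneous components; explicit form, no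
graded-ring instance, as in `MultigradedHilbertFunction.lean`). -/
def IsTrihomog (I : Ideal S) : Prop := ∀ p ∈ I, ∀ D, weightedHomogeneousComponent wt D p ∈ I

/-- `I` has the Hilbert function of `17` points in general position:
`dim I_D + min(17, dim S_D) = dim S_D` for EVERY multidegree `D` (so `I₀ = I₁₀₀ = I₀₁₀ = I₀₀₁ = 0`,
`codim I₁₁₀ = codim I₁₁₁ = 17`, …). This is where the rank threshold `17` of the crux enters. -/
def HasGenericHF (I : Ideal S) : Prop :=
  ∀ D, hdim I D + min 17 (Module.finrank ℂ ↥(SD D)) = Module.finrank ℂ ↥(SD D)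

/-- The exponent vector of the `(1,1,1)`-monomial `c_a · a_b · b_c`. -/
def mono111 (a b c : Fin 3 × Fin 3) : Var →₀ ℕ :=
  Finsupp.single ((0 : Fin 3), a) 1 + Finsupp.single ((1 : Fin 3), b) 1 + Finsupp.single ((2 : Fin 3), c) 1

/-- The apolarity pairing of `f ∈ S` with `T = ⟨3,3,3⟩ ∈ C ⊗ A ⊗ B` through the `(1,1,1)`-coefficients
of `f` (`T` has the entry `1` at `(a,b,c) = ((κ,ν),(κ,μ),(μ,ν))`: `⟨f, T⟩ = Σ_{κμν} coeff(c_{κν} a_{κμ} b_{μν}) f`). -/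
def pairT (f : S) : ℂ :=
  ∑ a : Fin 3 × Fin 3, ∑ b : Fin 3 × Fin 3, ∑ c : Fin 3 × Fin 3,
    coeff (mono111 a b c) f * matMulTensor ℂ 3 3 3 a b c

/-- `I ⊂ Ann(T)`: the `(1,1,1)`-forms of `I` are apolar to `T` (for an ideal this implies the slice
conditions `I₁₁₀ ⊂ T(C*)^⊥` etc. in the three degrees below, and `Ann(T)_D = S_D` in all other degrees). -/
def IsApolar (I : Ideal S) : Prop := ∀ f ∈ I, f ∈ SD (fun _ => 1) → pairT f = 0

/-- A CANDIDATE ideal of border apolarity for `(⟨3,3,3⟩, r = 17)`: trihomogeneous, generic Hilbert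
function of `17` points, apolar to `T` (a `ℂ`-point of `Hilb^{h₁₇}_S` inside `{I ⊂ Ann T}`). -/
def IsCandidate (I : Ideal S) : Prop := IsTrihomog I ∧ HasGenericHF I ∧ IsApolar I

/-! ## Vocabulary: the Borel action and its fixed flag point -/

/-- Upper triangular and invertible. -/
def IsUpperUnit (P : Matrix (Fin 3) (Fin 3) ℂ) : Prop := (∀ i j, j < i → P i j = 0) ∧ IsUnit P.det

/-- The substitution of variables induced by `g = (P, Q, R) ∈ GL₃³` acting on points of `C ⊕ A ⊕ B` by
`(c, a, b) ↦ (P⁻ᵀ c R⁻ᵀ, P a Q, Q⁻¹ b R)` (this action fixes `T = Σ E_{κν} ⊗ E_{κμ} ⊗ E_{μν}`):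
a variable, i.e. a coordinate function, is sent to its composite with `g`, a linear form. -/
def borelVar (P Q R : Matrix (Fin 3) (Fin 3) ℂ) : Var → S := fun v =>
  ![∑ i' : Fin 3, ∑ j' : Fin 3, C ((P⁻¹) i' v.2.1 * (R⁻¹) v.2.2 j') * X ((0 : Fin 3), i', j'),
    ∑ i' : Fin 3, ∑ j' : Fin 3, C (P v.2.1 i' * Q j' v.2.2) * X ((1 : Fin 3), i', j'),
    ∑ i' : Fin 3, ∑ j' : Fin 3, C ((Q⁻¹) v.2.1 i' * R j' v.2.2) * X ((2 : Fin 3), i', j')] v.1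

/-- `f ↦ f ∘ g` as a `ℂ`-algebra endomorphism of `S`. -/
def borelSubst (P Q R : Matrix (Fin 3) (Fin 3) ℂ) : S →ₐ[ℂ] S := MvPolynomial.aeval (borelVar P Q R)

/-- `I` is stable under the Borel subgroup `B = B₃ × B₃ × B₃` (upper triangular `P, Q, R`) of the
stabiliser of `T`. -/
def IsBorelStable (I : Ideal S) : Prop :=
  ∀ P Q R : Matrix (Fin 3) (Fin 3) ℂ, IsUpperUnit P → IsUpperUnit Q → IsUpperUnit R →
    ∀ f ∈ I, borelSubst P Q R f ∈ I

/-- The irrelevant ideal `S₊` of the `ℕ³`-grading, generated by the `(1,1,1)`-monomials (JM §2.4). -/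
def irrel : Ideal S :=
  Ideal.span (Set.range fun abc : (Fin 3 × Fin 3) × (Fin 3 × Fin 3) × (Fin 3 × Fin 3) =>
    X ((0 : Fin 3), abc.1) * X ((1 : Fin 3), abc.2.1) * X ((2 : Fin 3), abc.2.2))

/-- The saturation `I^{sat} = ⋃_n (I : S₊ⁿ)`. -/
def satur (I : Ideal S) : Ideal S := ⨆ n : ℕ, Submodule.colon I ((irrel ^ n : Ideal S) : Set S)

/-- The corner variables = the coordinates NOT vanishing at the unique `B`-fixed point
`p₀ = ([E₂₀], [E₀₂], [E₀₂]) ∈ ℙC × ℙA × ℙB` (`A`, `B` are sandwiched by upper triangular matrices, fixed line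
`ℂ·E₀₂`; `C` by lower triangular ones, fixed line `ℂ·E₂₀`). -/
def cornerVar : Fin 3 → Var :=
  ![((0 : Fin 3), (2 : Fin 3), (0 : Fin 3)), ((1 : Fin 3), (0 : Fin 3), (2 : Fin 3)),
    ((2 : Fin 3), (0 : Fin 3), (2 : Fin 3))]

/-- PUNCTUALITY at `p₀`: `V₊(I) ⊆ {p₀}`, i.e. every non-corner coordinate is nilpotent modulo `I^{sat}`
(`√(I^{sat}) ⊇ 𝔭₀`, the prime of `p₀`; multigraded Nullstellensatz form). -/
def IsPunctual (I : Ideal S) : Prop :=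
  ∀ v : Var, v ∉ Set.range cornerVar → (X v : S) ∈ (satur I).radical

/-! ## Vocabulary: limits of ideals of points (Slip) and sticky ideals -/

/-- Affine representatives of a `17`-tuple of points of `ℙC × ℙA × ℙB`. -/
abbrev Config : Type := Fin 17 → Var → ℂ

/-- Evaluation at the `17` points. -/
def evalAt (γ : Config) : S →ₗ[ℂ] (Fin 17 → ℂ) :=
  LinearMap.pi fun ρ => (MvPolynomial.aeval (γ ρ) : S →ₐ[ℂ] ℂ).toLinearMap

/-- `I(Γ)_D`: the `D`-forms vanishing at the `17` points (multihomogeneous, so projective vanishing). -/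
def vanishPiece (γ : Config) (D : Fin 3 → ℕ) : Submodule ℂ S := LinearMap.ker (evalAt γ) ⊓ SD D

/-- The `17` points are in general position in EVERY multidegree: they impose `min(17, dim S_D)`
independent conditions on `S_D` (a countable intersection of non-empty Zariski-open conditions; over `ℂ`
it holds off a countable union of proper closed subsets, and it follows from finitely many degrees). -/
def InGeneralPosition (γ : Config) : Prop :=
  ∀ D, Module.finrank ℂ ↥(vanishPiece γ D) + min 17 (Module.finrank ℂ ↥(SD D)) =
    Module.finrank ℂ ↥(SD D)

/-- Coefficientwise convergence of polynomials. -/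
def CoeffTendsto (fseq : ℕ → S) (f : S) : Prop :=
  ∀ m : Var →₀ ℕ, Tendsto (fun k => coeff m (fseq k)) atTop (𝓝 (coeff m f))

/-- Degreewise (lower) convergence of a sequence of graded pieces to the pieces of `I`: every element
of `I_D` is a coefficientwise limit of elements of the `k`-th piece. With equal dimensions on both sides
this is convergence in the Grassmannian of `S_D`, for every `D`. -/
def PiecesTendsto (Pk : ℕ → (Fin 3 → ℕ) → Submodule ℂ S) (I : Ideal S) : Prop :=
  ∀ D, ∀ f ∈ piece I D, ∃ fseq : ℕ → S, (∀ k, fseq k ∈ Pk k D) ∧ CoeffTendsto fseq f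

/-- `Γ` witnesses that `I` is a limit of ideals of `17` points in general position. -/
def IsSlipWitness (I : Ideal S) (Γ : ℕ → Config) : Prop :=
  (∀ k, InGeneralPosition (Γ k)) ∧ PiecesTendsto (fun k => vanishPiece (Γ k)) I

/-- `[I] ∈ Slip₁₇` (sequential form of JM Def. 3.10 / Buczyńska–Buczyński): `I` is a degreewise limit of
ideals of `17`-tuples of points in general position. -/
def IsSlipLimit (I : Ideal S) : Prop := ∃ Γ : ℕ → Config, IsSlipWitness I Γ

/-- `J` STICKS WITH `I` (Jelisiejew–Mańdziuk §1.2, sequential form): along EVERY sequence of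
trihomogeneous ideals with the Hilbert function of `I` converging degreewise to `I` (every `ℂ`-point
sequence `[I_k] → [I]` of `Hilb_I`), eventually some `J' ⊇ I_k` has the Hilbert function of `J`.
Quantifying over all such sequences (not only over ideals of points) makes this a genuine
deformation-theoretic property of `[I ⊆ J] ∈ Hilb_{I ⊆ J}`, implied by smoothness of `pr_I` at `[I ⊆ J]`
(JM Thm 3.4: `ObFib(I,J) = 0`; Thm 3.5: tangent-surjective + `[J]` smooth). -/
def Sticky (I J : Ideal S) : Prop :=
  ∀ Iseq : ℕ → Ideal S, (∀ k, IsTrihomog (Iseq k) ∧ ∀ D, hdim (Iseq k) D = hdim I D) →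
    PiecesTendsto (fun k => piece (Iseq k)) I →
    ∃ k, ∃ J' : Ideal S, IsTrihomog J' ∧ Iseq k ≤ J' ∧ ∀ D, hdim J' D = hdim J D

/-! ## Sanity lemmas on the vocabulary (sorry-free; guard against vacuous definitions) -/

/-- `I ≤ I^{sat}` (the `n = 0` term of the union: `(I : S) = I`). -/
theorem le_satur (I : Ideal S) : I ≤ satur I := by
  intro f hf
  refine Submodule.mem_iSup_of_mem 0 ?_
  rw [Submodule.mem_colon]
  intro p _
  simpa [smul_eq_mul, mul_comm] using I.mul_mem_left p hf

/-- The flag point is honest data: the three corner variables are pairwise distinct variables. -/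
theorem cornerVar_injective : Function.Injective cornerVar := by
  intro i j h
  fin_cases i <;> fin_cases j <;> simp_all [cornerVar]

/-- Landing hook (registered stub `stub_punctualVocabulary` of stmt-MatrixMultiplication-4958): every ideal lies in its
saturation. [folklore] -/
theorem stub_punctualVocabulary : ∀ I : Ideal S, I ≤ satur I := le_satur

end Summit.MatrixMultiplication.MatrixMultiplication.Theorems.PunctualSaturation

end
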